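import Summits.HodgeConjecture.CorCM.HypLiu418.RecordSystemAlongConjBase
import Summits.HodgeConjecture.CorCM.B01.Transposition.HComp.RecordSystemConjComplex
import HarnessLib

/-!
# B2 «same models, conjugate embedding» — the complex record system along `τ̄ = conj ∘ τ` (B2-ℂ)

Cell `hodgecm-mathlib`, fan A, off-place half of `HLiu418` (director g1 2026-08-28T03:49:27Z; design of record: A-p06
`A-provers/A-p06/B2-DESIGN-alongConj.md`, spec `RecordSystemAlongConjSpec.lean`; base ✔ `RecordSystemAlongConjBase.lean`).
For a complex record system `Sc : ComplexRecordSystem L H τ T hT K₀` of `Sh(U(H), 𝔹²)` ([Deligne1979ShimuraVarieties] 2.1.2–2.1.4 over `ℂ`)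
the functor `Sc.Mc ⋙ (·)^{conj}` carries a complex record system for the SAME hermitian space `H` and the SAME levels, read at the CONJUGATE
embedding `τ̄ := conj ∘ τ` with the conjugate frame `T̄ := conjFrame T` — the variance `(H, τ, T) ↦ (H, τ̄, T̄)` (compare the sibling
✔ `conjComplexRecordSystem` of `HComp/RecordSystemConjComplex.lean`, variance `(H, τ, T) ↦ (cH, τ, T̄)`, whose group transport `(c ⊗ 1)` and
level re-indexing disappear here).  At the complex level the two variances see the same matrix: `H^{τ̄} = conj ∘ H^{τ} = (cH)^{τ}`
(✔ `map_map_starRingEnd_eq_conjGram_map`).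

* §1 `ratToU21_alongConj`, `shimuraSetAlongConj : Sh_K(U(H), 𝔹²)_{τ,T}(ℂ) ≃ₜ Sh_K(U(H), 𝔹²)_{τ̄,T̄}(ℂ)`, `[x, a] ↦ [x̄, a]` (the group
  isomorphism is the identity of `U(H)(L⁺)`; equivariance `T̄⁻¹ γ^{τ̄} T̄ = conj (T⁻¹ γ^τ T)`).
* §2 `alongConjMc`, `alongConjPts` (+ the point formula `alongConjPts_symm_mk` by `rfl`), `alongConjPts_map_pts`, `hol_alongConjMc`,
  `pieces_alongConjMc`, and the structure literal **`ComplexRecordSystem.alongConj`** with `alongConj_Mc : (alongConj Sc).Mc = Sc.Mc ⋙ (·)^{conj}` (`rfl`).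

KERNEL: definitions by explicit formula + theorems; no instance, no notation, no named fact, no `sorry`.  HC_CM is NOT proved here;
HC_CM is proved only modulo the 7 printed citations until rung 0 closes.

References: [Deligne1979ShimuraVarieties] 2.1.2–2.1.4; [Milne2005ShimuraVarieties] §12, Lemma 5.13; [SerreGAGA1956] §2.
-/

set_option autoImplicit false

noncomputable section

open CategoryTheory AlgebraicGeometry NumberField IsDedekindDomain Matrix
open Literature.AlgebraicGeometry.Motives
open Literature.NumberTheory.Automorphic.Liu2021.AppendixC (C5.OpenCompactSubgroup C5.SmallLevel)

namespace Summit.HodgeConjecture.CorCM.Model.RecordSystemConj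

open Limits Function MulAction Topology
open scoped Matrix ComplexConjugate
open Literature.AlgebraicGeometry.ShimuraVarieties Literature.AlgebraicGeometry.ShimuraVarieties.UnitaryCanonicalModel
open Literature.AlgebraicGeometry.Motives.AlgPoints (toConjugate ofConjugate conjugateHomeomorph)
open Literature.NumberTheory.Automorphic Literature.NumberTheory.Automorphic.UnitaryGroup
open Literature.NumberTheory.Automorphic.ShimuraDissection
open Literature.Geometry.ComplexHyperbolic Literature.Geometry.ComplexHyperbolic.BallModel
open Summit.HodgeConjecture.CorCM.D2Bridge.UnitaryGroupConj

/-! ## §1 The Shimura set along the conjugate embedding: `[x, a] ↦ [x̄, a]` -/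

section ShimuraSetAlongConj

variable (L : Type) [Field L] [NumberField L] [IsCMField L] (H : Matrix (Fin 3) (Fin 3) L)
  (τ : L →+* ℂ) (T : GL (Fin 3) ℂ) (hT : formCongr (starRingEnd ℂ) T (H.map τ) = BallModel.J)

omit [NumberField L] [IsCMField L] in
/-- `GL₃(τ̄) γ = conj (GL₃(τ) γ)` for `τ̄ = conj ∘ τ` (entrywise). [folklore] -/
theorem glMap_starRingEnd_comp (γ : GL (Fin 3) L) :
    Matrix.GeneralLinearGroup.map ((starRingEnd ℂ).comp τ) γ = conjFrame (Matrix.GeneralLinearGroup.map τ γ) := by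
  refine Units.ext (Matrix.ext fun i j => ?_)
  simp only [conjFrame, Matrix.GeneralLinearGroup.map_apply, RingHom.coe_comp, Function.comp_apply]

/-- **`T̄⁻¹ γ^{τ̄} T̄ = conj (T⁻¹ γ^τ T)`**: the archimedean projection of `U(H)(L⁺)` at `(τ̄, T̄)` is the complex conjugate of the one at
`(τ, T)`. [folklore] -/
theorem ratToU21_alongConj (γ : rational (↥(maximalRealSubfield L)) L (IsCMField.complexConj L) 3 H) :
    ratToU21 L H ((starRingEnd ℂ).comp τ) (conjFrame T) (formCongr_conjFrame_starRingEnd_comp H τ T hT) γ =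
      conjU21 (ratToU21 L H τ T hT γ) := by
  apply Subtype.ext
  change ((archProjU21EmbCM L H ((starRingEnd ℂ).comp τ) (conjFrame T) (formCongr_conjFrame_starRingEnd_comp H τ T hT)
      (rationalToArch (↥(maximalRealSubfield L)) L (IsCMField.complexConj L) 3 H γ) : U21) : GL (Fin 3) ℂ) =
    conjFrame ((archProjU21EmbCM L H τ T hT
      (rationalToArch (↥(maximalRealSubfield L)) L (IsCMField.complexConj L) 3 H γ) : U21) : GL (Fin 3) ℂ)
  rw [coe_archProjU21EmbCM_rationalToArch, coe_archProjU21EmbCM_rationalToArch, glMap_starRingEnd_comp,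
    conjFrame, conjFrame, conjFrame, map_mul, map_mul, map_inv]

/-- **Equivariance of `x ↦ x̄`** for the actions of `U(H)(L⁺)` on the ball through `(τ, T)` and through `(τ̄, T̄)`: `(γ • x)‾ = γ • x̄`.
[folklore] -/
theorem conjBall_ratToU21_smul_alongConj (γ : rational (↥(maximalRealSubfield L)) L (IsCMField.complexConj L) 3 H) (x : Ball) :
    conjBall (ratToU21 L H τ T hT γ • x) =
      ratToU21 L H ((starRingEnd ℂ).comp τ) (conjFrame T) (formCongr_conjFrame_starRingEnd_comp H τ T hT) γ • conjBall x := by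
  rw [ratToU21_alongConj, conjU21_smul_conjBall]

/-- The ball factor `x ↦ x̄` between the `U(H)(L⁺)`-ball through `(τ, T)` and through `(τ̄, T̄)`. [folklore] -/
def ballFactorAlongConj :
    Through (ratToU21 L H τ T hT) Ball ≃ₜ
      Through (ratToU21 L H ((starRingEnd ℂ).comp τ) (conjFrame T) (formCongr_conjFrame_starRingEnd_comp H τ T hT)) Ball :=
  ((Through.mkHomeomorph (ratToU21 L H τ T hT) Ball).symm.trans conjBallHomeomorph).trans
    (Through.mkHomeomorph (ratToU21 L H ((starRingEnd ℂ).comp τ) (conjFrame T) (formCongr_conjFrame_starRingEnd_comp H τ T hT)) Ball)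

variable (K : Subgroup ↥(finAdelic (↥(maximalRealSubfield L)) L (IsCMField.complexConj L) 3 H))

/-- The product map `(x, aK) ↦ (x̄, aK)`. [folklore] -/
def pairAlongConj :
    Through (ratToU21 L H τ T hT) Ball ×
        CosetSpace (rationalToFinAdelic (↥(maximalRealSubfield L)) L (IsCMField.complexConj L) 3 H) K ≃ₜ
      Through (ratToU21 L H ((starRingEnd ℂ).comp τ) (conjFrame T) (formCongr_conjFrame_starRingEnd_comp H τ T hT)) Ball ×
        CosetSpace (rationalToFinAdelic (↥(maximalRealSubfield L)) L (IsCMField.complexConj L) 3 H) K :=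
  (ballFactorAlongConj L H τ T hT).prodCongr (Homeomorph.refl _)

/-- **Equivariance of `(x, aK) ↦ (x̄, aK)`** under `U(H)(L⁺)`. [folklore] -/
theorem pairAlongConj_smul (γ : rational (↥(maximalRealSubfield L)) L (IsCMField.complexConj L) 3 H)
    (p : Through (ratToU21 L H τ T hT) Ball ×
      CosetSpace (rationalToFinAdelic (↥(maximalRealSubfield L)) L (IsCMField.complexConj L) 3 H) K) :
    pairAlongConj L H τ T hT K (γ • p) = (MulEquiv.refl _) γ • pairAlongConj L H τ T hT K p := by
  obtain ⟨z, y⟩ := p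
  rw [Prod.smul_mk, MulEquiv.refl_apply, Prod.smul_mk]
  refine Prod.ext ?_ rfl
  change Through.mk _ Ball (conjBall (ratToU21 L H τ T hT γ • (Through.mk (ratToU21 L H τ T hT) Ball).symm z)) =
    γ • Through.mk _ Ball (conjBall ((Through.mk (ratToU21 L H τ T hT) Ball).symm z))
  rw [Through.smul_mk, conjBall_ratToU21_smul_alongConj]

/-- **The Shimura set along the conjugate embedding**: `Sh_K(U(H), 𝔹²)(ℂ)` presented at `(τ, T)` and at `(τ̄ = conj ∘ τ, T̄)` are
homeomorphic by `[x, aK] ↦ [x̄, aK]` (same group, same level; [Milne2005ShimuraVarieties] §12: the datum `(G, X̄)` read at the conjugate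
point). [cite: Milne2005ShimuraVarieties, Lemma 5.13 p. 57 and §12] -/
def shimuraSetAlongConj :
    ShimuraSet L H τ T hT K ≃ₜ
      ShimuraSet L H ((starRingEnd ℂ).comp τ) (conjFrame T) (formCongr_conjFrame_starRingEnd_comp H τ T hT) K :=
  orbitQuotientHomeomorphOfEquivariant (MulEquiv.refl _) (pairAlongConj L H τ T hT K) (pairAlongConj_smul L H τ T hT K)

/-- `shimuraSetAlongConj [x, aK] = [x̄, aK]`. [cite: Milne2005ShimuraVarieties, Lemma 5.13 p. 57] -/
@[simp] theorem shimuraSetAlongConj_mk (x : Ball) (a : ↥(finAdelic (↥(maximalRealSubfield L)) L (IsCMField.complexConj L) 3 H)) :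
    shimuraSetAlongConj L H τ T hT K (ShimuraSet.mk L H τ T hT K x a) =
      ShimuraSet.mk L H ((starRingEnd ℂ).comp τ) (conjFrame T) (formCongr_conjFrame_starRingEnd_comp H τ T hT) K (conjBall x) a :=
  rfl

/-- `shimuraSetAlongConj⁻¹ [x, aK] = [x̄, aK]`. [cite: Milne2005ShimuraVarieties, Lemma 5.13 p. 57] -/
@[simp] theorem shimuraSetAlongConj_symm_mk (x : Ball)
    (a : ↥(finAdelic (↥(maximalRealSubfield L)) L (IsCMField.complexConj L) 3 H)) :
    (shimuraSetAlongConj L H τ T hT K).symm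
        (ShimuraSet.mk L H ((starRingEnd ℂ).comp τ) (conjFrame T) (formCongr_conjFrame_starRingEnd_comp H τ T hT) K x a) =
      ShimuraSet.mk L H τ T hT K (conjBall x) a :=
  rfl

end ShimuraSetAlongConj

/-! ## §2 The complex record system along `τ̄`: `K ↦ (Mc_K)^{conj}` for the SAME `H` and the SAME levels -/

section AlongConj

variable {L : Type} [Field L] [NumberField L] [IsCMField L] {H : Matrix (Fin 3) (Fin 3) L}
  {τ : L →+* ℂ} {T : GL (Fin 3) ℂ} {hT : formCongr (starRingEnd ℂ) T (H.map τ) = BallModel.J}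
  {K₀ : C5.OpenCompactSubgroup ↥(finAdelic (↥(maximalRealSubfield L)) L (IsCMField.complexConj L) 3 H)}

/-- **The conjugate complex models at the same levels**: `K ↦ (Mc_K)^{conj} = Mc_K ⊗_{ℂ, conj} ℂ` (Serre's conjugate variety,
`Motives.baseChangeHom (starRingEnd ℂ)`). [cite: SerreGAGA1956, §2] [cite: Deligne1979ShimuraVarieties, 2.1.2] -/
def alongConjMc (Sc : ComplexRecordSystem L H τ T hT K₀) : C5.SmallLevel K₀ ⥤ SchemeOver ℂ :=
  Sc.Mc ⋙ baseChangeHom (starRingAut : ℂ ≃+* ℂ).toRingHom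

/-- `alongConjMc Sc = Sc.Mc ⋙ baseChangeHom conj` with Mathlib's `starRingEnd ℂ` (by `rfl`: `starRingAut.toRingHom = starRingEnd ℂ`
definitionally) — the spelling of the spec and of ✔ `modelsAlongConjIso`. [folklore] -/
theorem alongConjMc_eq (Sc : ComplexRecordSystem L H τ T hT K₀) : alongConjMc Sc = Sc.Mc ⋙ baseChangeHom (starRingEnd ℂ) :=
  rfl

/-- unfolding: `(alongConjMc Sc) K = conjugateVariety conj (Mc_K)` (by `rfl`). [folklore] -/
theorem alongConjMc_obj (Sc : ComplexRecordSystem L H τ T hT K₀) (K : C5.SmallLevel K₀) :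
    (alongConjMc Sc).obj K = conjugateVariety (starRingAut : ℂ ≃+* ℂ) (Sc.Mc.obj K) :=
  rfl

/-- unfolding: the transition maps of `alongConjMc Sc` are the conjugated transition maps of `Sc` (by `rfl`). [folklore] -/
theorem alongConjMc_map (Sc : ComplexRecordSystem L H τ T hT K₀) {K₁ K₂ : C5.SmallLevel K₀} (f : K₁ ⟶ K₂) :
    (alongConjMc Sc).map f = (baseChangeHom (starRingAut : ℂ ≃+* ℂ).toRingHom).map (Sc.Mc.map f) :=
  rfl

/-- (C1) `(Mc_K)^{conj}` is smooth of relative dimension `2` (base change). [folklore] -/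
theorem smooth_alongConjMc (Sc : ComplexRecordSystem L H τ T hT K₀) (K : C5.SmallLevel K₀) :
    AlgebraicGeometry.SmoothOfRelativeDimension 2 ((alongConjMc Sc).obj K).hom := by
  have := AlgebraicGeometry.smoothOfRelativeDimension_isStableUnderBaseChange 2
  exact MorphismProperty.pullback_snd (P := @AlgebraicGeometry.SmoothOfRelativeDimension 2) _ _ (Sc.smooth _)

/-- (C1) `(Mc_K)^{conj}` is projective over `ℂ` (base change). [folklore] -/
theorem projective_alongConjMc (Sc : ComplexRecordSystem L H τ T hT K₀) (K : C5.SmallLevel K₀) :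
    IsProjectiveOver ((alongConjMc Sc).obj K) :=
  letI : Algebra ℂ ℂ := ((starRingAut : ℂ ≃+* ℂ).toRingHom).toAlgebra
  (Sc.projective K).baseChange_obj ℂ

/-- **`alongConjPts`, the complex points of the conjugate complex model at the conjugate embedding**: for a small level `K ≤ K₀`,
`(Mc_K)^{conj}(ℂ) ≃ₜ Sh_K(U(H), 𝔹²)_{τ̄, T̄}(ℂ)` = (Serre's anti-holomorphic identification `conj(Y)(ℂ) ≃ₜ Y(ℂ)`,
`AlgPoints.conjugateHomeomorph`)⁻¹, then `Sc.pts K`, then §1's `shimuraSetAlongConj` `[x, aK] ↦ [x̄, aK]`.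
[cite: SerreGAGA1956, §2] [cite: Milne2005ShimuraVarieties, Lemma 5.13 p. 57 and §12] -/
def alongConjPts (Sc : ComplexRecordSystem L H τ T hT K₀) (K : C5.SmallLevel K₀) :
    ComplexPoints ((baseChangeHom (starRingAut : ℂ ≃+* ℂ).toRingHom).obj (Sc.Mc.obj K)) ≃ₜ
      ShimuraSet L H ((starRingEnd ℂ).comp τ) (conjFrame T) (formCongr_conjFrame_starRingEnd_comp H τ T hT) K.1.1 :=
  ((conjugateHomeomorph conjAut (Sc.Mc.obj K) Complex.continuous_conj).symm.trans (Sc.pts K)).trans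
    (shimuraSetAlongConj L H τ T hT K.1.1)

/-- **(P_ℂ) — the point formula, by `rfl`**: `alongConjPts⁻¹ [x, aK] = toConjugate ((Sc.pts K)⁻¹ [x̄, aK])`.
[cite: Milne2005ShimuraVarieties, Lemma 5.13 p. 57 and §12] -/
theorem alongConjPts_symm_mk (Sc : ComplexRecordSystem L H τ T hT K₀) (K : C5.SmallLevel K₀) (x : Ball)
    (a : finAdelic (↥(maximalRealSubfield L)) L (IsCMField.complexConj L) 3 H) :
    (alongConjPts Sc K).symm
        (ShimuraSet.mk L H ((starRingEnd ℂ).comp τ) (conjFrame T) (formCongr_conjFrame_starRingEnd_comp H τ T hT) K.1.1 x a) =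
      toConjugate conjAut (Sc.Mc.obj K) ((Sc.pts K).symm (ShimuraSet.mk L H τ T hT K.1.1 (conjBall x) a)) :=
  rfl

/-- `alongConjPts` of a conjugated point is the `shimuraSetAlongConj`-image of `Sc.pts` of the point. [cite: SerreGAGA1956, §2] -/
theorem alongConjPts_toConjugate (Sc : ComplexRecordSystem L H τ T hT K₀) (K : C5.SmallLevel K₀)
    (Q : ComplexPoints (Sc.Mc.obj K)) :
    alongConjPts Sc K (toConjugate conjAut (Sc.Mc.obj K) Q) = shimuraSetAlongConj L H τ T hT K.1.1 (Sc.pts K Q) := by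
  show shimuraSetAlongConj L H τ T hT K.1.1
      (Sc.pts K (ofConjugate conjAut (Sc.Mc.obj K) (toConjugate conjAut (Sc.Mc.obj K) Q))) = _
  rw [AlgPoints.ofConjugate_toConjugate]

/-- (C2a) transitions: `[z, aK₁] ↦ [z, aK₂]` on complex points of the conjugate models at `(τ̄, T̄)` (naturality of `toConjugate` +
`Sc.map_pts` + `shimuraSetAlongConj_mk`). [cite: Deligne1979ShimuraVarieties, 2.1.4] -/
theorem alongConjPts_map_pts (Sc : ComplexRecordSystem L H τ T hT K₀) (K₁ K₂ : C5.SmallLevel K₀) (f : K₁ ⟶ K₂) (z : Ball)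
    (a : finAdelic (↥(maximalRealSubfield L)) L (IsCMField.complexConj L) 3 H) :
    alongConjPts Sc K₂ (AlgPoints.map ((alongConjMc Sc).map f) ((alongConjPts Sc K₁).symm
        (ShimuraSet.mk L H ((starRingEnd ℂ).comp τ) (conjFrame T) (formCongr_conjFrame_starRingEnd_comp H τ T hT) K₁.1.1 z a))) =
      ShimuraSet.mk L H ((starRingEnd ℂ).comp τ) (conjFrame T) (formCongr_conjFrame_starRingEnd_comp H τ T hT) K₂.1.1 z a := by
  show alongConjPts Sc K₂ (AlgPoints.map ((baseChangeHom (starRingAut : ℂ ≃+* ℂ).toRingHom).map (Sc.Mc.map f))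
      ((alongConjPts Sc K₁).symm
        (ShimuraSet.mk L H ((starRingEnd ℂ).comp τ) (conjFrame T) (formCongr_conjFrame_starRingEnd_comp H τ T hT)
          K₁.1.1 z a))) = _
  rw [alongConjPts_symm_mk, map_baseChangeHom_map_toConjugate, alongConjPts_toConjugate, Sc.map_pts,
    shimuraSetAlongConj_mk, conjBall_conjBall]

/-- At the complex level the conjugate embedding and the conjugate hermitian space see the same matrix:
`H^{τ̄} = conj ∘ H^{τ} = (cH)^{τ}`. [folklore] -/
theorem map_starRingEnd_comp_eq_conjGram_map (H : Matrix (Fin 3) (Fin 3) L) (τ : L →+* ℂ) :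
    H.map ((starRingEnd ℂ).comp τ) = (conjGram L H).map τ := by
  rw [RingHom.coe_comp, ← Matrix.map_map, map_map_starRingEnd_eq_conjGram_map]

/-- (C2b): `z ↦ [z, aK]` is holomorphic on the tautological ball of `H^{τ̄}` (`= (cH)^τ`) in every algebraic coordinate of
`(Mc_K)^{conj}` — the sibling chain's `ComplexRecordSystem.hol_conj` (F2b) read through (P_ℂ). [cite: SerreGAGA1956, §2]
[cite: Deligne1979ShimuraVarieties, 2.1.2–2.1.4 (PDF p. 24 of Milne's translation)] -/
theorem hol_alongConjMc (Sc : ComplexRecordSystem L H τ T hT K₀) (K : C5.SmallLevel K₀)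
    (a : finAdelic (↥(maximalRealSubfield L)) L (IsCMField.complexConj L) 3 H) :
    ∃ u : (Fin 3 → ℂ) → ComplexPoints ((alongConjMc Sc).obj K),
      (∀ x : Ball, u (((conjFrame T : GL (Fin 3) ℂ) : Matrix (Fin 3) (Fin 3) ℂ) *ᵥ BallModel.lift x) =
          (alongConjPts Sc K).symm
            (ShimuraSet.mk L H ((starRingEnd ℂ).comp τ) (conjFrame T) (formCongr_conjFrame_starRingEnd_comp H τ T hT) K.1.1 x a)) ∧
      (∀ v ∈ negCone (H.map ((starRingEnd ℂ).comp τ)), ∀ c : ℂ, c ≠ 0 → u (c • v) = u v) ∧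
      ∀ (U : ((alongConjMc Sc).obj K).left.affineOpens)
        (f : ((alongConjMc Sc).obj K).left.presheaf.obj (Opposite.op (↑U : ((alongConjMc Sc).obj K).left.Opens))),
        DifferentiableOn ℂ
          (fun v ↦ AlgPoints.evalOrZero (↑U : ((alongConjMc Sc).obj K).left.Opens) f (u v))
          (negCone (H.map ((starRingEnd ℂ).comp τ)) ∩ u ⁻¹' {P | P.pt ∈ (↑U : ((alongConjMc Sc).obj K).left.Opens)}) := by
  obtain ⟨u, h1, h2, h3⟩ := ComplexRecordSystem.hol_conj Sc K a
  rw [map_starRingEnd_comp_eq_conjGram_map]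
  exact ⟨u, fun x => (h1 x).trans (alongConjPts_symm_mk Sc K x a).symm, h2, h3⟩

/-- (C2c): the pieces of `(Mc_K)^{conj}` at `(H, τ̄, T̄)` — the pieces of `Mc_K` base-changed along `conj` (cofan transported along the
equivalence `baseChangeHom conj` of `Sch/ℂ`, SAME index set and representatives `g_q`), with the COMPLEX-CONJUGATE ball data
`UnitaryBallUniformisationDatum.conjugate`: Gram matrix `conj (H^τ) = H^{τ̄}`, natural level `conj (Γ_H(g_q K g_q⁻¹)^{τ}) =
Γ_H(g_q K g_q⁻¹)^{τ̄}`, uniformisation `v ↦ conj (unif v̄)` matched with (P_ℂ).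
[cite: Deligne1979ShimuraVarieties, 2.1.2] [cite: Milne2005ShimuraVarieties, Lemma 5.13 p. 57] [cite: SerreGAGA1956, §2] -/
theorem pieces_alongConjMc (Sc : ComplexRecordSystem L H τ T hT K₀) (K : C5.SmallLevel K₀) :
    ∃ (g : orbitRel.Quotient (rational (↥(maximalRealSubfield L)) L (IsCMField.complexConj L) 3 H)
          (CosetSpace (rationalToFinAdelic (↥(maximalRealSubfield L)) L (IsCMField.complexConj L) 3 H) K.1.1) →
        finAdelic (↥(maximalRealSubfield L)) L (IsCMField.complexConj L) 3 H)
      (_ : ∀ q, Quotient.mk'' (CosetSpace.pt (rationalToFinAdelic _ L _ 3 H) K.1.1 (g q)) = q)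
      (X : orbitRel.Quotient (rational (↥(maximalRealSubfield L)) L (IsCMField.complexConj L) 3 H)
          (CosetSpace (rationalToFinAdelic (↥(maximalRealSubfield L)) L (IsCMField.complexConj L) 3 H) K.1.1) →
        SchemeOver ℂ)
      (ι : ∀ q, X q ⟶ (alongConjMc Sc).obj K)
      (_ : IsColimit (Cofan.mk ((alongConjMc Sc).obj K) ι))
      (B : ∀ q, UnitaryBallUniformisationDatum 2 (X q)),
      ∀ q, (B q).Hℂ = H.map ((starRingEnd ℂ).comp τ) ∧
        (B q).Γ.map (Matrix.GeneralLinearGroup.map ((B q).τ₁ : ↥(B q).E →+* ℂ)) =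
          (arithmeticLevel (↥(maximalRealSubfield L)) L (IsCMField.complexConj L) 3 H
            (K.1.1.map (MulAut.conj (g q)).toMonoidHom)).map (Matrix.GeneralLinearGroup.map ((starRingEnd ℂ).comp τ)) ∧
        ∀ x : Ball, AlgPoints.map (ι q)
            ((B q).unif (((conjFrame T : GL (Fin 3) ℂ) : Matrix (Fin 3) (Fin 3) ℂ) *ᵥ BallModel.lift x)) =
          (alongConjPts Sc K).symm
            (ShimuraSet.mk L H ((starRingEnd ℂ).comp τ) (conjFrame T) (formCongr_conjFrame_starRingEnd_comp H τ T hT) K.1.1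
              x (g q)) := by
  obtain ⟨g, hg, X, ι, hcol, B, hB⟩ := Sc.pieces K
  -- the transported cofan: base change along `conj` (an equivalence of `Sch/ℂ`)
  obtain ⟨h1⟩ := nonempty_isColimit_cofan_baseChangeHom_ringEquiv conjAut X ι hcol
  refine ⟨g, hg, fun q => (baseChangeHom conjAut.toRingHom).obj (X q),
    fun q => (baseChangeHom conjAut.toRingHom).map (ι q), h1,
    fun q => (B q).conjugate, fun q => ⟨?_, ?_, fun x => ?_⟩⟩
  · -- the Gram matrix `conj (H^τ) = H^{τ̄}`
    beta_reduce
    rw [UnitaryBallUniformisationDatum.conjugate_Hℂ_eq_map_conj, (hB q).1, Matrix.map_map, RingHom.coe_comp]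
  · -- the natural level `conj (Γ^{τ}) = Γ^{τ̄}`
    beta_reduce
    rw [UnitaryBallUniformisationDatum.conjugate_Γ_map_τ₁, (hB q).2.1, Subgroup.map_map,
      ← Matrix.GeneralLinearGroup.map_comp]
  · -- the uniformisation `z ↦ [z, g_q K]`
    beta_reduce
    have hstar : star ((((conjFrame T : GL (Fin 3) ℂ) : Matrix (Fin 3) (Fin 3) ℂ) *ᵥ BallModel.lift x)) =
        (T : Matrix (Fin 3) (Fin 3) ℂ) *ᵥ BallModel.lift (conjBall x) := by
      have hx : BallModel.lift x = star (BallModel.lift (conjBall x)) := by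
        rw [lift_conjBall, star_star]
      rw [hx, conjFrame_mulVec_star, star_star]
    rw [UnitaryBallUniformisationDatum.conjugate_unif, hstar, alongConjPts_symm_mk, ← (hB q).2.2 (conjBall x)]
    exact map_baseChangeHom_map_toConjugate conjAut (ι q) _

/-- **The complex record system ALONG THE CONJUGATE EMBEDDING**, as a structure literal.  For a complex record system `Sc` of
`Sh(U(H), 𝔹²)` below `K₀` read at `(τ, T)` ([Deligne1979ShimuraVarieties] 2.1.2–2.1.4 over `ℂ`), the system `K ↦ (Mc_K)^{conj}`
(`(·)^{conj} = · ×_{ℂ, conj} ℂ`, Serre's conjugate variety; SAME hermitian space `H`, SAME levels `K ≤ K₀`) is a complex record system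
read at the CONJUGATE embedding `τ̄ = conj ∘ τ` with the conjugate frame `T̄ = conjFrame T`: (C1) smooth ∕ projective by base change;
(C2a) `pts := alongConjPts` (`[x, aK] ↦ [x̄, aK]` after Serre's identification) with the transitions `[z, aK₁] ↦ [z, aK₂]`; (C2b) `hol` =
`ComplexRecordSystem.hol_conj` read through the point formula (P_ℂ); (C2c) `pieces` = the conjugated pieces.  This is the `Sc` argument of
`recordSystem_exists_of_descent` at `(τ̄, T̄)` in B2 («same models `R.M`, conjugate embedding»).
[cite: Deligne1979ShimuraVarieties, 2.1.2–2.1.4 (PDF p. 24 of Milne's translation)] [cite: Milne2005ShimuraVarieties, §12 and Lemma 5.13 p. 57]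
[cite: SerreGAGA1956, §2] -/
def ComplexRecordSystem.alongConj (Sc : ComplexRecordSystem L H τ T hT K₀) :
    ComplexRecordSystem L H ((starRingEnd ℂ).comp τ) (conjFrame T) (formCongr_conjFrame_starRingEnd_comp H τ T hT) K₀ where
  Mc := alongConjMc Sc
  smooth := smooth_alongConjMc Sc
  projective := projective_alongConjMc Sc
  pts := alongConjPts Sc
  map_pts := alongConjPts_map_pts Sc
  hol := hol_alongConjMc Sc
  pieces := pieces_alongConjMc Sc

/-- The models of `alongConj Sc` are `K ↦ (Mc_K)^{conj}`: `(alongConj Sc).Mc = Sc.Mc ⋙ baseChangeHom conj` (by `rfl`).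
[cite: SerreGAGA1956, §2] -/
theorem ComplexRecordSystem.alongConj_Mc (Sc : ComplexRecordSystem L H τ T hT K₀) :
    (ComplexRecordSystem.alongConj Sc).Mc = Sc.Mc ⋙ baseChangeHom (starRingEnd ℂ) :=
  rfl

/-- The model of `alongConj Sc` at `K` is the conjugate variety `(Mc_K)^{conj}` (by `rfl`). [cite: SerreGAGA1956, §2] -/
theorem ComplexRecordSystem.alongConj_Mc_obj (Sc : ComplexRecordSystem L H τ T hT K₀) (K : C5.SmallLevel K₀) :
    (ComplexRecordSystem.alongConj Sc).Mc.obj K = conjugateVariety conjAut (Sc.Mc.obj K) :=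
  rfl

/-- The points of `alongConj Sc` are `alongConjPts` (by `rfl`). [cite: Milne2005ShimuraVarieties, Lemma 5.13 p. 57] -/
theorem ComplexRecordSystem.alongConj_pts (Sc : ComplexRecordSystem L H τ T hT K₀) (K : C5.SmallLevel K₀) :
    (ComplexRecordSystem.alongConj Sc).pts K = alongConjPts Sc K :=
  rfl

/-- **(P_ℂ) for `alongConj Sc`**: `((alongConj Sc).pts K)⁻¹ [x, aK] = toConjugate ((Sc.pts K)⁻¹ [x̄, aK])` (by `rfl`).
[cite: Milne2005ShimuraVarieties, Lemma 5.13 p. 57 and §12] -/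
theorem ComplexRecordSystem.alongConj_pts_symm_mk (Sc : ComplexRecordSystem L H τ T hT K₀) (K : C5.SmallLevel K₀) (x : Ball)
    (a : finAdelic (↥(maximalRealSubfield L)) L (IsCMField.complexConj L) 3 H) :
    ((ComplexRecordSystem.alongConj Sc).pts K).symm
        (ShimuraSet.mk L H ((starRingEnd ℂ).comp τ) (conjFrame T) (formCongr_conjFrame_starRingEnd_comp H τ T hT) K.1.1 x a) =
      toConjugate conjAut (Sc.Mc.obj K) ((Sc.pts K).symm (ShimuraSet.mk L H τ T hT K.1.1 (conjBall x) a)) :=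
  rfl

/-- **(P_ℂ) for the complex shadow of a record system `R`** (the shape B2-R consumes, with the record's own `pts` and
`AlgPoints.baseChangeEquiv τ`): `((alongConj R_ℂ).pts K)⁻¹ [x, aK] = toConjugate (((R.pts K)⁻¹ [x̄, aK])_τ)` (by `rfl`).
[cite: Deligne1979ShimuraVarieties, 2.2.5] -/
theorem ComplexRecordSystem.alongConj_pts_symm_mk_record (R : RecordSystem L H τ T hT K₀) (K : C5.SmallLevel K₀) (x : Ball)
    (a : finAdelic (↥(maximalRealSubfield L)) L (IsCMField.complexConj L) 3 H) :
    letI : Algebra L ℂ := τ.toAlgebra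
    ((ComplexRecordSystem.alongConj R.complexRecordSystem).pts K).symm
        (ShimuraSet.mk L H ((starRingEnd ℂ).comp τ) (conjFrame T) (formCongr_conjFrame_starRingEnd_comp H τ T hT) K.1.1 x a) =
      toConjugate conjAut ((baseChangeHom τ).obj (R.M.obj K))
        (AlgPoints.baseChangeEquiv τ (R.M.obj K) ((R.pts K).symm (ShimuraSet.mk L H τ T hT K.1.1 (conjBall x) a))) :=
  rfl

end AlongConj

end Summit.HodgeConjecture.CorCM.Model.RecordSystemConj

end
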